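import Summits.FinalStateConjecture.FinalStateConjecture.Theses.StarvedNecks
import HarnessLib.Audit

/-!
# Birth skeleton v2 — crux `StarvedNecks.NecksCertifyR` (stmt-FinalStateConjecture-17574)

Lead `prover-line-stmt-FinalStateConjecture-17574-c9-0`, 2026-08-17 (route
`route-FinalStateConjecture-StarvedNecks`, rev 11).  Reshape of the registered birth skeleton v1
(`planner-skel-stmt-FinalStateConjecture-17574-0`, sha `4418e5d1…`, re-registered by lead c1-0; v1 stubs
`stub_labelMatching` (LM), `stub_posSoftAnchored` (PSA), `stub_neckGapDecay` (NGD)).  Crux (FIXED, concluded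
BY NAME by `NecksCertifyR_of`): every honest fixed-radius `C⁴` final-state decomposition of
`O = exteriorOf 𝒟 d.charted` with pairwise distinct label velocities re-seams into a `C²` decomposition of
the SAME `O` that is `HonestCore ∧ SEAMED`
(`Summit.FinalStateConjecture.FinalStateConjecture.Theses.StarvedNecks.NecksCertifyR`).

## Why v1 was reshaped (L4: one stub false-modulo-H as typed, one stub = a sibling crux)

* **PSA is parity-false as typed.**  `stub_posSoftAnchored` asks, for the SAME input `d`, a
  `NeckCertificate` whose clauses K4–K6 make ONE open embedding `Ψₐ` of the connected late model tube equal to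
  the input hole chart `Ψᵢ` inside `R₁+1` and to the input flat chart `Φ` on the collar `[4ρₐ, Rc+2]`.  Relabel
  one hole of any tube-anchored, gap-certified honest input by an `η`-reflection `Q` fixing `e₀` (and the
  transported spin axis): `Ψᵢ ∘ Q̃` is again a late chart converging to Kerr boosted by `ΛᵢQ`, the `(t, r)`-defined
  sets, `O`, `charted`, `TubeAnchored` and the gap certificates (`Ψg ∘ Q̃`) are unchanged, `‖ΛᵢQ‖ = ‖Λᵢ‖`, the
  velocity `ΛᵢQe₀ = Λᵢe₀` (so distinct velocities persist) — and K5/K6 then ask ONE injective continuous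
  `Ψₐ'` of the CONNECTED late tube to equal the reflected chart `Ψᵢ ∘ Ã` on the inner ball and `Φ` on the
  collar; in a globally charted witness (exact boosted Schwarzschild with Kerr–Schild identity charts) the local
  degree of an injective continuous self-map of a connected open subset of `ℝ⁴` is constant (Brouwer), `−1` on
  the ball, `+1` on the collar — contradiction.  Hence `Registered.stub_posSoftAnchored` (v1) is false modulo the
  existence of one globally charted, tube-anchored, gap-certified honest input with `0 < d.N` (parity finding F1
  of the lead of the sibling crux stmt-FinalStateConjecture-18060, `Cruxes/GapDecaySuffices/NOTES.md`; a paper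
  argument, not kernel-checked — degree theory is not in Mathlib; same mechanism as the landed
  `…Theorems.GapDecaySuffices.Negative.PosCoreFalseOfLabelSwapWitness`, p137241, for label swaps).  The crux is
  untouched (its conclusion `∃ d₂ …` is label- and orientation-free), so the repair is to let the gauge step output
  a RELABELLED honest `d'` of the same `O` carrying the certificate.
* **LM ∧ PSA-repaired is the sibling crux.**  With that repair, `stub_labelMatching ∧ stub_posSoftAnchored'` is,
  token for token, `NeckGapDecay`'s gap certificates ⟹ `NecksCertifyR`, i.e. the route item
  `Theses.StarvedNecks.GapDecaySuffices := NeckGapDecay → NecksCertifyR` (stmt-FinalStateConjecture-18060), which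
  has its own lead, its own registered skeleton (`Cruxes/GapDecaySuffices/Lines/Sketch.lean`: S3 switch-off, S4
  anchored location, S5 assembly, `stub_labelMatching` in the radius-windowed form `TubeAnchoredR`) and landed
  stubs (p137784 `stub_gapBootstrap`, p138385 `stub_flatFarCertified`, p138641 `stub_clopenSurjection`,
  p138651 `stub_collarLateFlat`).  Re-running LM/PSA here would re-prove that crux's registered stubs under
  other names.
* **The route already composes the crux this way.**  Route text rev 6/11 (`Theses/StarvedNecks.lean`, ranked
  cruxes: "NecksCertifyR (the cut item: implied by NeckGapDecay ∧ GapDecaySuffices, no longer a `closes`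
  hypothesis …; crux staffing should key on NeckGapDecay)") and the deciding theorem `closes`, which uses
  `have hS : NecksCertifyR := h₃ h₂`.

So v2 composes the crux from the two ROUTE ITEMS BY NAME — `stub_neckGapDecay` (kept) and
`stub_gapDecaySuffices` (replacing LM + PSA) — and keeps the v1 statements, typed and `sorry`-free, under
`Retired` as the record of what was cut and why.  Wave: none (both open stubs are sibling crux items with live
leads; no worker is briefed on another chain's crux).  Disproof used: `Cruxes/GapDecaySuffices/Disproof.lean`
(`posCore_false_of_labelSwapWitness`, `TubeAnchored` §4) and the stmt-18060 lead's parity finding F1; the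
predecessor `Cruxes/NecksCertify/Disproof.lean` has no `_false_without_` theorem; no `Disproof.lean` exists
for this crux (2026-08-17T04Z).
-/

noncomputable section

open scoped Manifold ContDiff Topology ENNReal
open Filter Set MeasureTheory Topology Literature.Geometry.Lorentzian

namespace Summit.FinalStateConjecture.FinalStateConjecture.Cruxes.NecksCertifyR.Birth

set_option linter.dupNamespace false
set_option linter.unusedVariables false

/-! ## Registered stubs (v2): the two route items that cut the crux -/

/-- **Registered stub NGD — the route's physics crux BY NAME** (`Theses.StarvedNecks.NeckGapDecay`,
stmt-FinalStateConjecture-16768, open-problem-adjacent, staffed by the crux chain of that item; lead line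
`Cruxes/NeckGapDecay/PICKED.md`; when it closes, this stub is discharged by `exact`).  Gap annulus
`{Rg(τ) < rᵢ ≤ ρᵢ}`: two derivatives of the vacuum metric decay in a hole-anchored gauge out to a wall
`W ≥ 3ρᵢ+2` — HUYGENS AT RADIUS ρ (cone ledger; linear model kernel-checked p87050, p104311/p111535,
p112122, p113590). -/
theorem stub_neckGapDecay : Theses.StarvedNecks.NeckGapDecay := by
  sorry

/-- **Registered stub GDS — the route's gauge crux BY NAME** (`Theses.StarvedNecks.GapDecaySuffices :=
NeckGapDecay → NecksCertifyR`, stmt-FinalStateConjecture-18060; staffed by the crux chain of that item, lead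
skeleton `Cruxes/GapDecaySuffices/Lines/Sketch.lean` with landed stubs p137784, p138385, p138641, p138651; when it
closes, this stub is discharged by `exact`).  It is exactly v1's `stub_labelMatching ∧ stub_posSoftAnchored`
once PSA is repaired to output a relabelled decomposition (see the module docstring and `Retired`). -/
theorem stub_gapDecaySuffices : Theses.StarvedNecks.GapDecaySuffices := by
  sorry

/-! ## Name-keyed statements of the registered stubs

`Registered.stub_X` is the statement of the registered stub `stub_X` under the stub's own short name (device of
the v5 skeleton of the predecessor crux and of v1), so that the native skeleton audit reads the hypotheses of
`NecksCertifyR_of` as the registered stubs / route items BY NAME. -/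
namespace Registered

/-- Statement of `stub_neckGapDecay` (NGD): the route decl itself. -/
abbrev stub_neckGapDecay : Prop := Theses.StarvedNecks.NeckGapDecay

/-- Statement of `stub_gapDecaySuffices` (GDS): the route decl itself. -/
abbrev stub_gapDecaySuffices : Prop := Theses.StarvedNecks.GapDecaySuffices

end Registered

/-- Consistency check: the registered stubs prove their name-keyed statements. -/
example : Registered.stub_neckGapDecay ∧ Registered.stub_gapDecaySuffices :=
  ⟨stub_neckGapDecay, stub_gapDecaySuffices⟩

/-! ## The composition (kernel-checked, no sorry of its own) -/

/-- **Skeleton theorem (v2).**  NGD → GDS → the crux `Theses.StarvedNecks.NecksCertifyR`, BY NAME: the gauge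
item is by definition `NeckGapDecay → NecksCertifyR`, so the crux is its value at the physics item — verbatim the
step `have hS : NecksCertifyR := h₃ h₂` of the route's deciding theorem `Theses.StarvedNecks.closes` (rev 6). -/
theorem NecksCertifyR_of (hNGD : Theses.StarvedNecks.NeckGapDecay)
    (hGDS : Theses.StarvedNecks.GapDecaySuffices) : Theses.StarvedNecks.NecksCertifyR :=
  hGDS hNGD

/-- Wiring check: the registered stubs feed `NecksCertifyR_of` as stated (an `example`, so that
`NecksCertifyR_of` stays the unique theorem of this file concluding the crux). -/
example : Theses.StarvedNecks.NecksCertifyR :=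
  NecksCertifyR_of stub_neckGapDecay stub_gapDecaySuffices

/-- Converse bookkeeping (why nothing is lost by the cut): given the physics item, the crux and the gauge item
are EQUIVALENT — `GapDecaySuffices` is then exactly what remains of `NecksCertifyR`. -/
theorem necksCertifyR_iff_gapDecaySuffices (hNGD : Theses.StarvedNecks.NeckGapDecay) :
    Theses.StarvedNecks.NecksCertifyR ↔ Theses.StarvedNecks.GapDecaySuffices :=
  ⟨fun h _ ↦ h, fun h ↦ h hNGD⟩

/-! ## Retired v1 stubs (record only — NOT registered, no `sorry`)

The let-bound bundles of the crux and the v1 stub statements, typed against the current tree, with the reason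
each was retired.  Nothing below is used by `NecksCertifyR_of`. -/
namespace Retired

/-- `HonestCore` = the crux's `Hc` (verbatim): sub-extremal holes, `100·Mᵢ ≤ R₀`, orthochronous labels;
anchoring of hole-late points below later discs of every radius `≥ R₀`; relative closedness of late tube
portions; future-oriented flat chart. -/
def HonestCore (𝓢 : Spacetime.{0} 4) (O : Set 𝓢.carrier) (k : ℕ) (d : FinalStateDecomposition 𝓢 O k)
    (R₀ : ℝ) : Prop :=
  let B := d.background; let t := fun i ↦ (B i).time; let r := fun i ↦ (B i).radius; let Ψ := d.chart;
  (∀ i, Kerr.IsSubextremal (d.mass i) (d.spin i) ∧ 100 * d.mass i ≤ R₀ ∧ 0 < ((d.motion i).1 : E4 ≃L[ℝ] E4) (E4.basisVector 0) 0) ∧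
    (∀ i (ϱ τ₂ : ℝ), R₀ ≤ ϱ → d.τ₀ < τ₂ → Ψ i '' {x | d.τ₀ < t i x.1 ∧ t i x.1 < τ₂ ∧ r i x.1 < ϱ} ⊆ 𝓢.metric.causalPast 𝓢.timeOrientation (Ψ i '' (B i).truncTimeSlab ϱ τ₂)) ∧
    (∀ i (τ' : ℝ) (ϱ : ℝ → ℝ), Continuous ϱ → d.τ₀ < τ' → let A := Ψ i '' {x | τ' ≤ t i x.1 ∧ r i x.1 ≤ ϱ (t i x.1)}; closure A ∩ O ⊆ A) ∧
    (∀ y : d.flatDomain, d.τ₀ < y.1 0 → 𝓢.timeOrientation.IsFutureDirected (mfderiv 𝓘(ℝ, E4) (𝓡 4) d.flatChart y (E4.basisVector 0)))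

/-- `HonestFar` = the crux's `Hf` (verbatim): flat-late points below later flat slabs; closures of far
flat slabs are flat points; eventually each hole chart is `C⁰`-honest (`1/(10‖Λᵢ‖²)`) on its own Voronoi
cell beyond `R₀`. -/
def HonestFar (𝓢 : Spacetime.{0} 4) (O : Set 𝓢.carrier) (k : ℕ) (d : FinalStateDecomposition 𝓢 O k)
    (R₀ : ℝ) : Prop :=
  let B := d.background; let t := fun i ↦ (B i).time; let r := fun i ↦ (B i).radius; let Φ := d.flatChart;
  (∀ τ₂ : ℝ, d.τ₀ < τ₂ → Φ '' {y | d.τ₀ < y.1 0 ∧ y.1 0 < τ₂} ⊆ 𝓢.metric.causalPast 𝓢.timeOrientation (Φ '' (Minkowski.backgroundOn d.flatDomain).timeSlab τ₂)) ∧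
    (∀ τ' : ℝ, d.τ₀ < τ' → closure (Φ '' {y | τ' ≤ y.1 0 ∧ ∀ i, d.excision i (y.1 0) + 1 ≤ r i y.1}) ⊆ Φ '' {y | τ' ≤ y.1 0}) ∧
    (∀ i, ∃ T : ℝ, supCkENorm (Subtype.val '' {x : (B i).domain | T ≤ t i x.1 ∧ R₀ ≤ r i x.1 ∧ ∀ j, j ≠ i → r i x.1 ≤ r j x.1}) 0 (𝓢.deviationExtend (B i) (d.chart i)) ≤ ENNReal.ofReal (1 / (10 * ‖(((d.motion i).1 : E4 ≃L[ℝ] E4) : E4 →L[ℝ] E4)‖ ^ 2)))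

/-- **`TubeAnchored d`** (verbatim `Cruxes/GapDecaySuffices/Disproof.lean` §4): eventually in flat time, the
INPUT hole chart `i` maps the thin model collar `ρᵢ(y⁰)+1 ≤ rᵢ y ≤ 2ρᵢ(y⁰)+1` into the flat chart's image of
the thicker collar `|y'⁰ − y⁰| ≤ ρᵢ(y⁰)`, `rᵢ y' ≤ 3ρᵢ(y⁰)+1` around the SAME label line.  Set-theoretic;
parity-blind (an `η`-reflection of the hole chart fixing `e₀` preserves it) — which is why it cannot rescue PSA. -/
def TubeAnchored {𝓢 : Spacetime.{0} 4} {O : Set 𝓢.carrier} {k : ℕ}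
    (d : FinalStateDecomposition 𝓢 O k) : Prop :=
  ∀ i, ∃ T : ℝ, ∀ (y : E4) (hy : y ∈ (d.background i).domain), T ≤ y 0 →
    d.excision i (y 0) + 1 ≤ (d.background i).radius y →
    (d.background i).radius y ≤ 2 * d.excision i (y 0) + 1 →
      d.chart i ⟨y, hy⟩ ∈ d.flatChart '' {y' : d.flatDomain |
        |y'.1 0 - y 0| ≤ d.excision i (y 0) ∧ (d.background i).radius y'.1 ≤ 3 * d.excision i (y 0) + 1}

/-- **`GapCertificate 𝓢 O d R₀ i`** — the per-hole conclusion of the route decl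
`Theses.StarvedNecks.NeckGapDecay` (stmt-16768), VERBATIM (G1–G5). -/
def GapCertificate (𝓢 : Spacetime.{0} 4) (O : Set 𝓢.carrier) (d : FinalStateDecomposition 𝓢 O 4) (R₀ : ℝ)
    (i : Fin d.N) : Prop :=
  ∃ (R₁ τ₁ : ℝ) (W : ℝ → ℝ) (Ψg : (d.background i).domain → 𝓢.carrier),
    let B := d.background i; let t := B.time; let r := B.radius;
    R₀ ≤ R₁ ∧ d.τ₀ ≤ τ₁ ∧ Continuous W ∧ (∀ s, τ₁ ≤ s → 3 * d.excision i s + 2 ≤ W s) ∧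
      (let U : Set B.domain := {x | τ₁ < t x.1 ∧ r x.1 < W (x.1 0) + 1};
        ContMDiffOn 𝓘(ℝ, E4) (𝓡 4) ∞ Ψg U ∧ Topology.IsOpenEmbedding (U.restrict Ψg) ∧ Ψg '' U ⊆ d.charted) ∧
      (∀ x : B.domain, r x.1 ≤ R₁ + 1 → Ψg x = d.chart i x) ∧
      Tendsto (fun τ ↦ supCkENorm (Subtype.val '' {x : B.domain | t x.1 = τ ∧ r x.1 ≤ W (x.1 0)}) 2
        (𝓢.deviationExtend B Ψg)) atTop (𝓝 0) ∧
      (∀ x : B.domain, τ₁ ≤ t x.1 → R₁ ≤ r x.1 → r x.1 ≤ W (x.1 0) →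
        𝓢.timeOrientation.IsFutureDirected
          (mfderiv 𝓘(ℝ, E4) (𝓡 4) Ψg x (((d.motion i).1 : E4 ≃L[ℝ] E4) (E4.basisVector 0)))) ∧
      (∀ (τ' : ℝ) (ϱ : ℝ → ℝ), Continuous ϱ → τ₁ < τ' →
        (∀ x : B.domain, τ' ≤ t x.1 → r x.1 ≤ ϱ (t x.1) → r x.1 ≤ W (x.1 0)) →
        closure (Ψg '' {x | τ' ≤ t x.1 ∧ r x.1 ≤ ϱ (t x.1)}) ∩ O ⊆ Ψg '' {x | τ' ≤ t x.1 ∧ r x.1 ≤ ϱ (t x.1)})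

/-- **`NeckCertificate 𝓢 O d R₀`** — the v5 analysis atlas K1–K12 (verbatim the bundle of the landed
reduction p131681).  K4 (open embedding of the connected late tube) ∧ K5 (`Ψₐ = Ψᵢ` inside `R₁+1`) ∧ K6
(`Ψₐ = Φ` on `[4ρₐ, Rc+2]`) is the parity-sensitive triple. -/
def NeckCertificate (𝓢 : Spacetime.{0} 4) (O : Set 𝓢.carrier) (d : FinalStateDecomposition 𝓢 O 4)
    (R₀ : ℝ) : Prop :=
  let B := d.background; let t := fun i ↦ (B i).time; let r := fun i ↦ (B i).radius
  let Λ := fun i ↦ ((d.motion i).1 : E4 ≃L[ℝ] E4); let Φ := d.flatChart; let Ψ := d.chart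
  let ρ := d.excision
  ∃ (R₁ τ₁ : ℝ) (ρa Rc : Fin d.N → ℝ → ℝ) (Ψa : ∀ i, (B i).domain → 𝓢.carrier),
    R₀ ≤ R₁ ∧ d.τ₀ ≤ τ₁ ∧
    (∀ i, Monotone (ρa i) ∧ Continuous (ρa i) ∧ Tendsto (fun s ↦ ρa i s / s) atTop (𝓝 0) ∧
      Tendsto (ρa i) atTop atTop ∧ ∀ s, R₁ + 1 ≤ ρa i s ∧ (τ₁ ≤ s → ρ i s + 1 ≤ ρa i s)) ∧
    (∀ i, Monotone (Rc i) ∧ Continuous (Rc i) ∧ Tendsto (fun s ↦ Rc i s / s) atTop (𝓝 0) ∧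
      Tendsto (Rc i) atTop atTop ∧ ∀ s, R₁ + 4 ≤ Rc i s) ∧
    (∀ j (y : E4), τ₁ ≤ y 0 → r j y ≤ 9 * ρa j (y 0) → r j y + 3 ≤ Rc j (t j y)) ∧
    (∀ i, let U : Set (B i).domain := {x | τ₁ < t i x.1 ∧ r i x.1 < Rc i (t i x.1) + 2}
      ContMDiffOn 𝓘(ℝ, E4) (𝓡 4) ∞ (Ψa i) U ∧ IsOpenEmbedding (U.restrict (Ψa i)) ∧
        Ψa i '' U ⊆ d.charted) ∧
    (∀ i (x : (B i).domain), r i x.1 ≤ R₁ + 1 → Ψa i x = Ψ i x) ∧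
    (∀ i (y : E4) (hy : y ∈ (B i).domain), τ₁ ≤ y 0 → 4 * ρa i (y 0) ≤ r i y →
      r i y ≤ Rc i (t i y) + 2 → ∃ hy' : y ∈ d.flatDomain, Ψa i ⟨y, hy⟩ = Φ ⟨y, hy'⟩) ∧
    (∀ i, Tendsto (fun τ ↦ 𝓢.truncDeviationCk (B i) (Ψa i) 2 (Rc i τ) τ) atTop (𝓝 0)) ∧
    (∀ i, supCkENorm (Subtype.val '' {x : (B i).domain | τ₁ ≤ t i x.1 ∧ R₁ ≤ r i x.1 ∧
        r i x.1 ≤ Rc i (t i x.1) + 2}) 0 (𝓢.deviationExtend (B i) (Ψa i)) ≤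
      ENNReal.ofReal (1 / (10 * ‖(Λ i : E4 →L[ℝ] E4)‖ ^ 2))) ∧
    (∀ i (x : (B i).domain), τ₁ ≤ t i x.1 → R₁ ≤ r i x.1 → r i x.1 ≤ Rc i (t i x.1) + 2 →
      𝓢.timeOrientation.IsFutureDirected
        (mfderiv 𝓘(ℝ, E4) (𝓡 4) (Ψa i) x ((Λ i) (E4.basisVector 0)))) ∧
    (∀ i j, i ≠ j → Disjoint (Ψa i '' {x | τ₁ < t i x.1 ∧ r i x.1 < Rc i (t i x.1) + 2})
      (Ψa j '' {x | τ₁ < t j x.1 ∧ r j x.1 < Rc j (t j x.1) + 2})) ∧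
    (∀ i (τ' : ℝ) (ϱ : ℝ → ℝ), Continuous ϱ → τ₁ < τ' → (∀ s, ϱ s < Rc i s + 2) →
      closure (Ψa i '' {x | τ' ≤ t i x.1 ∧ r i x.1 ≤ ϱ (t i x.1)}) ∩ O ⊆
        Ψa i '' {x | τ' ≤ t i x.1 ∧ r i x.1 ≤ ϱ (t i x.1)}) ∧
    (∀ (T : ℝ) (Th : Fin d.N → ℝ), τ₁ < T → (∀ j, τ₁ < Th j) →
      (∀ j (y : E4), T < y 0 → r j y ≤ Rc j (t j y) + 2 → Th j < t j y) →
      O \ (Φ '' {y | T < y.1 0 ∧ ∀ j, 5 * ρa j (y.1 0) < r j y.1} ∪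
          ⋃ j, Ψa j '' {x | Th j < t j x.1 ∧ r j x.1 < Rc j (t j x.1) + 2}) ⊆
        𝓢.metric.causalPast 𝓢.timeOrientation
          (Φ '' {y | y.1 0 = T ∧ ∀ j, 5 * ρa j (y.1 0) < r j y.1} ∪
            ⋃ j, Ψa j '' {x | t j x.1 = Th j ∧ r j x.1 < Rc j (t j x.1) + 2}))

/-- **Retired v1 stub LM (statement only).**  Every honest input admits a TUBE-ANCHORED honest
re-description of the same `O`.  Retired because (i) together with the repaired PSA it is the sibling crux
`GapDecaySuffices` (stmt-18060), whose lead registers the same stub (radius-windowed, `TubeAnchoredR`) and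
reports it as the misstatement boundary of that crux — no typed handle for tube containment / location in
`Hc`/`Hf`/DV/structure (cards C/k1, Disproof §2, wave-1 S4 worker, lead); recommended repair: the input
clause `Hf`(4) := `TubeAnchoredR d R₀`, free for every capture theorem — and (ii) set-level anchoring is
parity-blind, so LM cannot feed an un-relabelled PSA anyway. -/
abbrev LabelMatching : Prop :=
  ∀ (X : Type) [TopologicalSpace X] [ChartedSpace E3 X] [IsManifold (𝓡 3) ∞ X] [ConnectedSpace X]
    (D : InitialDataSet (𝓡 3) X), D ∈ admissibleVacuumData X →
    ∀ 𝒟 : VacuumCauchyDevelopment D, 𝒟.IsMaximal →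
    ∀ (O : Set 𝒟.carrier) (d : FinalStateDecomposition 𝒟.toSpacetime O 4) (R₀ : ℝ),
      O = exteriorOf 𝒟.toCauchyDevelopment d.charted →
      HonestCore 𝒟.toSpacetime O 4 d R₀ → HonestFar 𝒟.toSpacetime O 4 d R₀ →
      (∀ i j : Fin d.N, i ≠ j →
        ((d.motion i).1 : E4 ≃L[ℝ] E4) (E4.basisVector 0) ≠ ((d.motion j).1 : E4 ≃L[ℝ] E4) (E4.basisVector 0)) →
      ∃ (d' : FinalStateDecomposition 𝒟.toSpacetime O 4) (R₀' : ℝ),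
        O = exteriorOf 𝒟.toCauchyDevelopment d'.charted ∧
        HonestCore 𝒟.toSpacetime O 4 d' R₀' ∧ HonestFar 𝒟.toSpacetime O 4 d' R₀' ∧
        (∀ i j : Fin d'.N, i ≠ j →
          ((d'.motion i).1 : E4 ≃L[ℝ] E4) (E4.basisVector 0) ≠ ((d'.motion j).1 : E4 ≃L[ℝ] E4) (E4.basisVector 0)) ∧
        TubeAnchored d'

/-- **Retired v1 stub PSA (statement only).**  For a tube-anchored honest input with distinct velocities and
`0 < d.N`, gap certificates ⟹ a `NeckCertificate` for the SAME `d`.  Retired because it is false modulo the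
existence of one globally charted such input (parity, module docstring; paper argument F1 of the stmt-18060
lead): the certificate's K4–K6 pin one injective chart of a connected tube to both input charts, and an
`η`-reflected relabelling of the hole chart — again honest, tube-anchored, gap-certified — flips the relative
orientation.  Repaired form (output a relabelled `d'` of the same `O`) = stmt-18060's S3–S5. -/
abbrev PosSoftAnchored : Prop :=
  ∀ (X : Type) [TopologicalSpace X] [ChartedSpace E3 X] [IsManifold (𝓡 3) ∞ X] [ConnectedSpace X]
    (D : InitialDataSet (𝓡 3) X), D ∈ admissibleVacuumData X →
    ∀ 𝒟 : VacuumCauchyDevelopment D, 𝒟.IsMaximal →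
    ∀ (O : Set 𝒟.carrier) (d : FinalStateDecomposition 𝒟.toSpacetime O 4) (R₀ : ℝ),
      O = exteriorOf 𝒟.toCauchyDevelopment d.charted →
      HonestCore 𝒟.toSpacetime O 4 d R₀ → HonestFar 𝒟.toSpacetime O 4 d R₀ →
      (∀ i j : Fin d.N, i ≠ j →
        ((d.motion i).1 : E4 ≃L[ℝ] E4) (E4.basisVector 0) ≠ ((d.motion j).1 : E4 ≃L[ℝ] E4) (E4.basisVector 0)) →
      TubeAnchored d → 0 < d.N →
      (∀ i : Fin d.N, GapCertificate 𝒟.toSpacetime O d R₀ i) →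
      NeckCertificate 𝒟.toSpacetime O d R₀

/-- **The repaired gauge step (statement only, for the record)** — what PSA must say to survive parity: the
certificate is carried by SOME honest relabelling `d'` of the same `O` with `0 < d'.N`.  With LM in front
this is exactly what stmt-18060's skeleton proves stub by stub; it is not registered here. -/
abbrev PosSoftRelabelled : Prop :=
  ∀ (X : Type) [TopologicalSpace X] [ChartedSpace E3 X] [IsManifold (𝓡 3) ∞ X] [ConnectedSpace X]
    (D : InitialDataSet (𝓡 3) X), D ∈ admissibleVacuumData X →
    ∀ 𝒟 : VacuumCauchyDevelopment D, 𝒟.IsMaximal →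
    ∀ (O : Set 𝒟.carrier) (d : FinalStateDecomposition 𝒟.toSpacetime O 4) (R₀ : ℝ),
      O = exteriorOf 𝒟.toCauchyDevelopment d.charted →
      HonestCore 𝒟.toSpacetime O 4 d R₀ → HonestFar 𝒟.toSpacetime O 4 d R₀ →
      (∀ i j : Fin d.N, i ≠ j →
        ((d.motion i).1 : E4 ≃L[ℝ] E4) (E4.basisVector 0) ≠ ((d.motion j).1 : E4 ≃L[ℝ] E4) (E4.basisVector 0)) →
      0 < d.N → (∀ i : Fin d.N, GapCertificate 𝒟.toSpacetime O d R₀ i) →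
      ∃ (d' : FinalStateDecomposition 𝒟.toSpacetime O 4) (R₀' : ℝ),
        O = exteriorOf 𝒟.toCauchyDevelopment d'.charted ∧
        HonestCore 𝒟.toSpacetime O 4 d' R₀' ∧ HonestFar 𝒟.toSpacetime O 4 d' R₀' ∧
        (∀ i j : Fin d'.N, i ≠ j →
          ((d'.motion i).1 : E4 ≃L[ℝ] E4) (E4.basisVector 0) ≠ ((d'.motion j).1 : E4 ≃L[ℝ] E4) (E4.basisVector 0)) ∧
        0 < d'.N ∧ NeckCertificate 𝒟.toSpacetime O d' R₀'

end Retired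

end Summit.FinalStateConjecture.FinalStateConjecture.Cruxes.NecksCertifyR.Birth

end
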